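import Summits.Ventures.PercRepro.C025Profile
import Summits.Ventures.PercRepro.RankLevelSetF

/-!
# C-032 «PROFILE (Π)» — the level split at a non-loop, the rank-`0` row, and the binomial prices (night-3 g6)

Tools for the parallel-pair step of `(Π_{1,u})` (`C025ProfileParallel.lean`):

* `card_levelSet_of_indep_singleton`: for a non-loop `e`,
  `#levelSet M (u+1) = #levelSet (M ＼ {e}) (u+1) + #levelSet (M ／ {e}) u`
  (deletion–contraction of the level count), with the underlying set identities
  `filter_notMem_levelSet_eq` / `image_erase_filter_mem_levelSet_eq`;
* `profileIneq_zero`: the row `q = 0` of `(Π)` holds for every finite matroid and every `v`;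
* `P1`, `P0`: the prices of rank-`1` / rank-`0` sets as functions of the rank `r` of the complement
  (`P1 r u = [u ≤ r]·C(r+1,u)/(r+1)`, `P0 r v = [v ≤ r]·C(r,v)`), with the binomial facts
  `P1_le_P0 : P1 r (u+1) ≤ P0 (r-1) u`, `P1_succ_le_P0 : P1 (r+1) (u+1) ≤ P0 r u`, `P0_mono`.

Imports: `C025Profile` (the statement) and `RankLevelSetF` (`delete_singleton_eRk_eq`, `contract_singleton_eRk_add_one`).
-/

open scoped Matroid

namespace PercRepro

open Set Finset ThmH

section NonLoopSplit

variable {α : Type} [DecidableEq α] {M : Matroid α} [M.Finite]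

/-- The ground finset of `M ／ {e}`. -/
theorem gr_contract_singleton (e : α) : gr (M ／ ({e} : Set α)) = (gr M).erase e := by
  apply Finset.coe_injective
  rw [coe_gr, Finset.coe_erase, coe_gr, Matroid.contract_ground]

/-- The ground finset of `M ＼ {e}`. -/
theorem gr_delete_singleton'' (e : α) : gr (M ＼ ({e} : Set α)) = (gr M).erase e := by
  apply Finset.coe_injective
  rw [coe_gr, Finset.coe_erase, coe_gr, Matroid.delete_ground]

/-- **The level split at a non-loop `e`**: `#levelSet M (u+1) = #levelSet (M＼e) (u+1) + #levelSet (M／e) u`. -/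
theorem card_levelSet_of_indep_singleton {e : α} (he : M.Indep {e}) (u : ℕ) :
    (Shadow.levelSet M (u + 1)).card =
      (Shadow.levelSet (M ＼ ({e} : Set α)) (u + 1)).card + (Shadow.levelSet (M ／ ({e} : Set α)) u).card := by
  classical
  have heE : e ∈ gr M := by rw [← Finset.mem_coe, coe_gr]; exact he.subset_ground (Set.mem_singleton e)
  rw [← Finset.card_filter_add_card_filter_not (s := Shadow.levelSet M (u + 1)) (fun S => e ∈ S), add_comm]
  congr 1
  · -- sets avoiding e
    congr 1
    ext S
    simp only [Finset.mem_filter, Profile.mem_levelSet, gr_delete_singleton'']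
    constructor
    · rintro ⟨⟨hS, hr⟩, heS⟩
      refine ⟨fun x hx => Finset.mem_erase.2 ⟨fun h => heS (h ▸ hx), hS hx⟩, ?_⟩
      rw [delete_singleton_eRk_eq]
      · exact hr
      · intro x hx
        exact ⟨by rw [← coe_gr]; exact_mod_cast hS hx, by rw [Set.mem_singleton_iff]; rintro rfl; exact heS hx⟩
    · rintro ⟨hS, hr⟩
      have heS : e ∉ S := fun h => (Finset.mem_erase.1 (hS h)).1 rfl
      have hS' : S ⊆ gr M := hS.trans (Finset.erase_subset _ _)
      refine ⟨⟨hS', ?_⟩, heS⟩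
      rw [delete_singleton_eRk_eq] at hr
      · exact hr
      · intro x hx
        exact ⟨by rw [← coe_gr]; exact_mod_cast hS' hx, by rw [Set.mem_singleton_iff]; rintro rfl; exact heS hx⟩
  · -- sets containing e ↔ (erase e) sets of rank u in M ／ {e}
    rw [← Finset.card_image_of_injOn (f := fun S => S.erase e)]
    · congr 1
      ext S'
      simp only [Finset.mem_image, Finset.mem_filter, Profile.mem_levelSet, gr_contract_singleton]
      constructor
      · rintro ⟨S, ⟨⟨hS, hr⟩, heS⟩, rfl⟩
        refine ⟨fun x hx => ?_, ?_⟩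
        · rw [Finset.mem_erase] at hx ⊢; exact ⟨hx.1, hS hx.2⟩
        · have hsub : ((S.erase e : Finset α) : Set α) ⊆ M.E \ {e} := by
            intro x hx
            rw [Finset.mem_coe, Finset.mem_erase] at hx
            exact ⟨by rw [← coe_gr]; exact_mod_cast hS hx.2, by rw [Set.mem_singleton_iff]; exact hx.1⟩
          have h1 := contract_singleton_eRk_add_one he hsub
          have h2 : (insert e ((S.erase e : Finset α) : Set α)) = (S : Set α) := by
            rw [← Finset.coe_insert, Finset.insert_erase heS]
          rw [h2, hr] at h1
          have h3 : (M ／ ({e} : Set α)).eRk ((S.erase e : Finset α) : Set α) + 1 = (u : ℕ∞) + 1 := by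
            rw [h1]; push_cast; rfl
          exact WithTop.add_right_cancel (ENat.coe_ne_top 1) h3
      · rintro ⟨hS', hr⟩
        have heS' : e ∉ S' := fun h => (Finset.mem_erase.1 (hS' h)).1 rfl
        have hS'g : S' ⊆ gr M := hS'.trans (Finset.erase_subset _ _)
        refine ⟨insert e S', ⟨⟨Finset.insert_subset heE hS'g, ?_⟩, Finset.mem_insert_self _ _⟩, Finset.erase_insert heS'⟩
        have hsub : ((S' : Finset α) : Set α) ⊆ M.E \ {e} := by
          intro x hx
          exact ⟨by rw [← coe_gr]; exact_mod_cast hS'g hx, by rw [Set.mem_singleton_iff]; rintro rfl; exact heS' hx⟩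
        have h1 := contract_singleton_eRk_add_one he hsub
        rw [hr] at h1
        rw [Finset.coe_insert, ← h1]; push_cast; rfl
    · intro S hS S₂ hS₂ h
      simp only [Finset.coe_filter, Profile.mem_levelSet] at hS hS₂
      simp only at h
      rw [← Finset.insert_erase hS.2, ← Finset.insert_erase hS₂.2, h]


/-- The sets of `levelSet M u` avoiding a non-loop `e` are `levelSet (M ＼ {e}) u`. -/
theorem filter_notMem_levelSet_eq (e : α) (u : ℕ) :
    (Shadow.levelSet M u).filter (fun S => e ∉ S) = Shadow.levelSet (M ＼ ({e} : Set α)) u := by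
  ext S
  simp only [Finset.mem_filter, Profile.mem_levelSet, gr_delete_singleton'']
  constructor
  · rintro ⟨⟨hS, hr⟩, heS⟩
    refine ⟨fun x hx => Finset.mem_erase.2 ⟨fun h => heS (h ▸ hx), hS hx⟩, ?_⟩
    rw [delete_singleton_eRk_eq]
    · exact hr
    · intro x hx
      exact ⟨by rw [← coe_gr]; exact_mod_cast hS hx, by rw [Set.mem_singleton_iff]; rintro rfl; exact heS hx⟩
  · rintro ⟨hS, hr⟩
    have heS : e ∉ S := fun h => (Finset.mem_erase.1 (hS h)).1 rfl
    have hS' : S ⊆ gr M := hS.trans (Finset.erase_subset _ _)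
    refine ⟨⟨hS', ?_⟩, heS⟩
    rw [delete_singleton_eRk_eq] at hr
    · exact hr
    · intro x hx
      exact ⟨by rw [← coe_gr]; exact_mod_cast hS' hx, by rw [Set.mem_singleton_iff]; rintro rfl; exact heS hx⟩

/-- The sets of `levelSet M (u+1)` containing a non-loop `e`, with `e` erased, are `levelSet (M ／ {e}) u`. -/
theorem image_erase_filter_mem_levelSet_eq {e : α} (he : M.Indep {e}) (u : ℕ) :
    ((Shadow.levelSet M (u + 1)).filter (fun S => e ∈ S)).image (fun S => S.erase e) =
      Shadow.levelSet (M ／ ({e} : Set α)) u := by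
  have heE : e ∈ gr M := by rw [← Finset.mem_coe, coe_gr]; exact he.subset_ground (Set.mem_singleton e)
  ext S'
  simp only [Finset.mem_image, Finset.mem_filter, Profile.mem_levelSet, gr_contract_singleton]
  constructor
  · rintro ⟨S, ⟨⟨hS, hr⟩, heS⟩, rfl⟩
    refine ⟨fun x hx => ?_, ?_⟩
    · rw [Finset.mem_erase] at hx ⊢; exact ⟨hx.1, hS hx.2⟩
    · have hsub : ((S.erase e : Finset α) : Set α) ⊆ M.E \ {e} := by
        intro x hx
        rw [Finset.mem_coe, Finset.mem_erase] at hx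
        exact ⟨by rw [← coe_gr]; exact_mod_cast hS hx.2, by rw [Set.mem_singleton_iff]; exact hx.1⟩
      have h1 := contract_singleton_eRk_add_one he hsub
      have h2 : (insert e ((S.erase e : Finset α) : Set α)) = (S : Set α) := by
        rw [← Finset.coe_insert, Finset.insert_erase heS]
      rw [h2, hr] at h1
      have h3 : (M ／ ({e} : Set α)).eRk ((S.erase e : Finset α) : Set α) + 1 = (u : ℕ∞) + 1 := by
        rw [h1]; push_cast; rfl
      exact WithTop.add_right_cancel (ENat.coe_ne_top 1) h3
  · rintro ⟨hS', hr⟩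
    have heS' : e ∉ S' := fun h => (Finset.mem_erase.1 (hS' h)).1 rfl
    have hS'g : S' ⊆ gr M := hS'.trans (Finset.erase_subset _ _)
    refine ⟨insert e S', ⟨⟨Finset.insert_subset heE hS'g, ?_⟩, Finset.mem_insert_self _ _⟩, Finset.erase_insert heS'⟩
    have hsub : ((S' : Finset α) : Set α) ⊆ M.E \ {e} := by
      intro x hx
      exact ⟨by rw [← coe_gr]; exact_mod_cast hS'g hx, by rw [Set.mem_singleton_iff]; rintro rfl; exact heS' hx⟩
    have h1 := contract_singleton_eRk_add_one he hsub
    rw [hr] at h1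
    rw [Finset.coe_insert, ← h1]; push_cast; rfl

/-- `erase e` is injective on the sets containing `e`. -/
theorem erase_injOn_filter_mem (T : Finset (Finset α)) (e : α) :
    Set.InjOn (fun S : Finset α => S.erase e) (T.filter (fun S => e ∈ S) : Finset (Finset α)) := by
  intro S hS S₂ hS₂ h
  simp only [Finset.coe_filter] at hS hS₂
  simp only at h
  rw [← Finset.insert_erase hS.2, ← Finset.insert_erase hS₂.2, h]

end NonLoopSplit

section Zero

variable {α : Type} [DecidableEq α] {M : Matroid α} [M.Finite]

/-- A rank-`0` set does not lower the rank of its complement: `ρ(E ∖ B) = ρ(E)`. -/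
theorem eRk_compl_of_eRk_zero {B : Finset α} (hB : B ⊆ gr M) (h0 : M.eRk (B : Set α) = 0) :
    M.eRk ((gr M \ B : Finset α) : Set α) = M.eRank := by
  apply le_antisymm (M.eRk_le_eRank _)
  have h1 : M.eRank = M.eRk (((gr M \ B : Finset α) : Set α) ∪ (B : Set α)) := by
    rw [← Finset.coe_union, Finset.sdiff_union_of_subset hB, coe_gr, M.eRank_def]
  rw [h1]
  calc M.eRk (((gr M \ B : Finset α) : Set α) ∪ (B : Set α))
      ≤ M.eRk ((gr M \ B : Finset α) : Set α) + M.eRk (B : Set α) := M.eRk_union_le_eRk_add_eRk _ _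
    _ = M.eRk ((gr M \ B : Finset α) : Set α) := by rw [h0, add_zero]

omit [M.Finite] in
/-- Adding a rank-`0` set does not change the rank. -/
theorem eRk_union_of_eRk_zero {B T : Finset α} (h0 : M.eRk (B : Set α) = 0) :
    M.eRk ((B ∪ T : Finset α) : Set α) = M.eRk (T : Set α) := by
  apply le_antisymm
  · rw [Finset.coe_union]
    calc M.eRk ((B : Set α) ∪ (T : Set α)) ≤ M.eRk (B : Set α) + M.eRk (T : Set α) := M.eRk_union_le_eRk_add_eRk _ _
      _ = M.eRk (T : Set α) := by rw [h0, zero_add]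
  · exact M.eRk_mono (by rw [Finset.coe_union]; exact Set.subset_union_right)

/-- **`(Π_{0,v})` for every finite matroid**: `#levelSet M v ≥ #{rank-0 sets}·[v ≤ ρ(E)]·C(ρ(E), v)` — every rank-`0` set
`B` (a set of loops) and every `v`-subset `T` of a fixed basis give a distinct rank-`v` set `B ∪ T`. -/
theorem profileIneq_zero (v : ℕ) : Profile.ProfileIneq M 0 v := by
  classical
  unfold Profile.ProfileIneq
  have hRtop : M.eRank ≠ ⊤ := M.eRank_ne_top_iff.2 inferInstance
  set R := M.eRank.toNat with hR
  -- every rank-0 set has price [v ≤ R]·C(R, v)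
  have hprice : ∀ B ∈ Profile.Rq M 0, Profile.price M 0 v B = if v ≤ R then (Nat.choose R v : ℚ) else 0 := by
    intro B hB
    rw [Profile.mem_Rq] at hB
    unfold Profile.price
    rw [eRk_compl_of_eRk_zero hB.1 (by exact_mod_cast hB.2), ← ENat.coe_toNat hRtop, ENat.toNat_coe]
    simp only [add_zero, Nat.choose_zero_right, Nat.cast_one, div_one]
    by_cases hv : v ≤ R
    · rw [if_pos (by exact_mod_cast hv), if_pos hv]
    · rw [if_neg (by exact_mod_cast hv), if_neg hv]
  rw [Finset.sum_congr rfl hprice, Finset.sum_const, nsmul_eq_mul]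
  by_cases hv : v ≤ R
  · rw [if_pos hv]
    -- a basis as a finset
    obtain ⟨Bs, hBs⟩ := M.exists_isBase
    have hBsfin : Bs.Finite := M.ground_finite.subset hBs.subset_ground
    set Bf : Finset α := hBsfin.toFinset with hBf
    have hBfc : Bf.card = R := by
      have h1 : M.eRank = Bs.encard := hBs.encard_eq_eRank.symm
      rw [hR, h1, ← hBsfin.coe_toFinset, Set.encard_coe_eq_coe_finsetCard, ENat.toNat_coe]
    have hBfg : Bf ⊆ gr M := by
      intro x hx
      rw [← Finset.mem_coe, coe_gr]
      exact hBs.subset_ground (by rw [← hBsfin.mem_toFinset]; exact hx)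
    -- the injection (B, T) ↦ B ∪ T into the level
    have hmap : ∀ x ∈ (Profile.Rq M 0) ×ˢ Finset.powersetCard v Bf, x.1 ∪ x.2 ∈ Shadow.levelSet M v := by
      rintro ⟨B, T⟩ hx
      rw [Finset.mem_product, Profile.mem_Rq, Finset.mem_powersetCard] at hx
      rw [Profile.mem_levelSet]
      refine ⟨Finset.union_subset hx.1.1 (hx.2.1.trans hBfg), ?_⟩
      rw [eRk_union_of_eRk_zero (by exact_mod_cast hx.1.2)]
      have hind : M.Indep (T : Set α) := hBs.indep.subset (by
        intro x hx'; rw [← hBsfin.mem_toFinset]; exact hx.2.1 (by exact_mod_cast hx'))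
      rw [hind.eRk_eq_encard, Set.encard_coe_eq_coe_finsetCard, hx.2.2]
    have hinj : Set.InjOn (fun x : Finset α × Finset α => x.1 ∪ x.2)
        ((Profile.Rq M 0) ×ˢ Finset.powersetCard v Bf : Finset (Finset α × Finset α)) := by
      rintro ⟨B, T⟩ hx ⟨B', T'⟩ hx' h
      simp only [Finset.coe_product, Set.mem_prod, Finset.mem_coe, Profile.mem_Rq, Finset.mem_powersetCard] at hx hx'
      simp only at h
      -- B = (B ∪ T) ∩ loops-part: T ∩ Bf-part. B ⊆ rank-0 sets are disjoint from the independent Bf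
      have hdisj : ∀ (B₀ T₀ : Finset α), B₀ ⊆ gr M → M.eRk (B₀ : Set α) = 0 → T₀ ⊆ Bf → Disjoint B₀ T₀ := by
        intro B₀ T₀ hB₀ h0 hT₀
        rw [Finset.disjoint_left]
        intro x hxB hxT
        have hind : M.Indep ({x} : Set α) := hBs.indep.subset (by
          intro y hy; rw [Set.mem_singleton_iff] at hy; subst hy; rw [← hBsfin.mem_toFinset]; exact hT₀ hxT)
        have h1 : M.eRk ({x} : Set α) ≤ M.eRk (B₀ : Set α) := M.eRk_mono (by simpa using hxB)
        rw [hind.eRk_eq_encard, Set.encard_singleton, h0] at h1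
        exact absurd h1 (by decide)
      have hB : B = (B ∪ T).filter (fun x => x ∉ Bf) := by
        ext x; simp only [Finset.mem_filter, Finset.mem_union]
        constructor
        · intro hxB
          refine ⟨Or.inl hxB, fun hxf => ?_⟩
          exact Finset.disjoint_left.1 (hdisj B Bf hx.1.1 (by exact_mod_cast hx.1.2) (subset_refl _)) hxB hxf
        · rintro ⟨hxBT | hxBT, hxf⟩
          · exact hxBT
          · exact absurd (hx.2.1 hxBT) hxf
      have hB' : B' = (B' ∪ T').filter (fun x => x ∉ Bf) := by
        ext x; simp only [Finset.mem_filter, Finset.mem_union]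
        constructor
        · intro hxB
          refine ⟨Or.inl hxB, fun hxf => ?_⟩
          exact Finset.disjoint_left.1 (hdisj B' Bf hx'.1.1 (by exact_mod_cast hx'.1.2) (subset_refl _)) hxB hxf
        · rintro ⟨hxBT | hxBT, hxf⟩
          · exact hxBT
          · exact absurd (hx'.2.1 hxBT) hxf
      have hT : T = (B ∪ T).filter (fun x => x ∈ Bf) := by
        ext x; simp only [Finset.mem_filter, Finset.mem_union]
        constructor
        · intro hxT; exact ⟨Or.inr hxT, hx.2.1 hxT⟩
        · rintro ⟨hxBT | hxBT, hxf⟩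
          · exact absurd hxf (Finset.disjoint_left.1 (hdisj B Bf hx.1.1 (by exact_mod_cast hx.1.2) (subset_refl _)) hxBT)
          · exact hxBT
      have hT' : T' = (B' ∪ T').filter (fun x => x ∈ Bf) := by
        ext x; simp only [Finset.mem_filter, Finset.mem_union]
        constructor
        · intro hxT; exact ⟨Or.inr hxT, hx'.2.1 hxT⟩
        · rintro ⟨hxBT | hxBT, hxf⟩
          · exact absurd hxf (Finset.disjoint_left.1 (hdisj B' Bf hx'.1.1 (by exact_mod_cast hx'.1.2) (subset_refl _)) hxBT)
          · exact hxBT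
      rw [Prod.mk.injEq]
      exact ⟨by rw [hB, hB', h], by rw [hT, hT', h]⟩
    have hcard := Finset.card_le_card_of_injOn _ hmap hinj
    rw [Finset.card_product, Finset.card_powersetCard, hBfc] at hcard
    exact_mod_cast hcard
  · rw [if_neg hv, mul_zero]
    exact Nat.cast_nonneg _

end Zero

section Binomials

/-- Binomial fact (A): `C(p+1,u) ≤ (p+1)·C(p−1,u−1)` for `1 ≤ u ≤ p`. -/
theorem choose_succ_le_mul_choose_pred {p u : ℕ} (hu : 1 ≤ u) (hup : u ≤ p) :
    Nat.choose (p + 1) u ≤ (p + 1) * Nat.choose (p - 1) (u - 1) := by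
  obtain ⟨u', rfl⟩ : ∃ u', u = u' + 1 := ⟨u - 1, by omega⟩
  obtain ⟨p', rfl⟩ : ∃ p', p = p' + 1 := ⟨p - 1, by omega⟩
  simp only [Nat.add_sub_cancel]
  -- (p'+2)·C(p'+1,u') = C(p'+2,u'+1)·(u'+1);  C(p',u')·(p'+1) = C(p'+1,u')·(p'+1-u')
  have h1 := Nat.add_one_mul_choose_eq (p' + 1) u'
  have h2 := Nat.choose_mul_succ_eq p' u'
  -- want: C(p'+2,u'+1) ≤ (p'+2)·C(p',u')
  have hu' : u' + 1 ≤ p' + 1 := hup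
  have key : Nat.choose (p' + 1 + 1) (u' + 1) * ((u' + 1) * (p' + 1 - u')) =
      (p' + 1 + 1) * (p' + 1) * Nat.choose p' u' := by
    calc Nat.choose (p' + 1 + 1) (u' + 1) * ((u' + 1) * (p' + 1 - u'))
        = (Nat.choose (p' + 1 + 1) (u' + 1) * (u' + 1)) * (p' + 1 - u') := by ring
      _ = ((p' + 1 + 1) * Nat.choose (p' + 1) u') * (p' + 1 - u') := by rw [← h1]
      _ = (p' + 1 + 1) * (Nat.choose (p' + 1) u' * (p' + 1 - u')) := by ring
      _ = (p' + 1 + 1) * (Nat.choose p' u' * (p' + 1)) := by rw [← h2]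
      _ = (p' + 1 + 1) * (p' + 1) * Nat.choose p' u' := by ring
  have hpos : 0 < (u' + 1) * (p' + 1 - u') := Nat.mul_pos (by omega) (by omega)
  have hle : p' + 1 ≤ (u' + 1) * (p' + 1 - u') := by
    obtain ⟨d, hd⟩ : ∃ d, p' = u' + d := ⟨p' - u', by omega⟩
    subst hd
    rw [show u' + d + 1 - u' = d + 1 by omega]
    nlinarith [Nat.zero_le (u' * d)]
  have : Nat.choose (p' + 1 + 1) (u' + 1) * ((u' + 1) * (p' + 1 - u')) ≤
      ((p' + 1 + 1) * Nat.choose p' u') * ((u' + 1) * (p' + 1 - u')) := by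
    rw [key]
    calc (p' + 1 + 1) * (p' + 1) * Nat.choose p' u' = ((p' + 1 + 1) * Nat.choose p' u') * (p' + 1) := by ring
      _ ≤ ((p' + 1 + 1) * Nat.choose p' u') * ((u' + 1) * (p' + 1 - u')) := Nat.mul_le_mul_left _ hle
  exact Nat.le_of_mul_le_mul_right this hpos


/-- `P1 r u = [u ≤ r]·C(r+1,u)/(r+1)`: the price of a rank-`1` set whose complement has rank `r`. -/
noncomputable def P1 (r u : ℕ) : ℚ := if u ≤ r then (Nat.choose (r + 1) u : ℚ) / ((r : ℚ) + 1) else 0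

/-- `P0 r v = [v ≤ r]·C(r,v)`: the price of a rank-`0` set whose complement has rank `r`. -/
noncomputable def P0 (r v : ℕ) : ℚ := if v ≤ r then (Nat.choose r v : ℚ) else 0

/-- `P1 r (u+1) ≤ P0 (r−1) u` (binomial fact (A)). -/
theorem P1_le_P0 (r u : ℕ) : P1 r (u + 1) ≤ P0 (r - 1) u := by
  unfold P1 P0
  by_cases h : u + 1 ≤ r
  · rw [if_pos h, if_pos (by omega)]
    have hA := choose_succ_le_mul_choose_pred (p := r) (u := u + 1) (by omega) h
    simp only [Nat.add_sub_cancel] at hA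
    have hr : (0 : ℚ) < (r : ℚ) + 1 := by positivity
    rw [div_le_iff₀ hr]
    have : ((Nat.choose (r + 1) (u + 1) : ℕ) : ℚ) ≤ (((r + 1) * Nat.choose (r - 1) u : ℕ) : ℚ) := by exact_mod_cast hA
    push_cast at this
    linarith
  · rw [if_neg h]
    split_ifs
    · exact Nat.cast_nonneg _
    · exact le_rfl

/-- `P1 (r+1) (u+1) ≤ P0 r u` (binomial fact (A) at `r + 1`). -/
theorem P1_succ_le_P0 (r u : ℕ) : P1 (r + 1) (u + 1) ≤ P0 r u := by
  have := P1_le_P0 (r + 1) u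
  simpa using this


/-- `P0` is monotone in the rank. -/
theorem P0_mono {r r' : ℕ} (h : r ≤ r') (v : ℕ) : P0 r v ≤ P0 r' v := by
  unfold P0
  split_ifs with h1 h2
  · exact_mod_cast Nat.choose_le_choose v h
  · omega
  · exact Nat.cast_nonneg _
  · exact le_rfl


end Binomials

end PercRepro
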